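import Literature.MathematicalPhysics.QuantumLattice.SymmetricLocalCertificate
import HarnessLib

/-!
# Bootstrap certificates read in the ORBIT-AVERAGED VECTOR STATE of an energy eigenvector

Family `hubbard` (topic `MathematicalPhysics/QuantumLattice`). Companion to
`Matrix.re_projState_ge_of_local_certificate` (SymmetricLocalCertificate), which evaluates a
local-objective certificate `X − c·1 = Σᵢⱼ Λᵢⱼ Oᵢᴴ Oⱼ + (Σ (A Xₖ − Xₖ A) + Σ (Uₗ Yₗ Uₗᴴ − Yₗ)
+ Σ (Zᵣ (Qᵣ − qᵣ) + (Qᵣ − qᵣ) Z'ᵣ) + Σ (Cⱼ Wⱼ − Wⱼ Cⱼ)) + (Σ dₘ • (Vₘᴴ − Vₘ) + Σ aₖ • Mₖ)` in the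
TRACIAL ground state of a sector — on a degenerate level a statement about the normalised trace
over the multiplet, not about individual eigenvectors. Here the same identity is evaluated in the
ORBIT-AVERAGED VECTOR STATE `ω̄_v = |G|⁻¹ Σ_g ⟨T_gᴴ v, · T_gᴴ v⟩` (`orbitState T v`) of ONE unit
eigenvector `A v = E v` in a sector `K`, for a finite family of unitaries `T_g` commuting with `A`,
adjoints preserving `K`, CLOSED under right multiplication by every symmetry `Uₗ` of the certificate
(`T_g Uₗ = T_{σₗ g}`, `σₗ` a permutation; e.g. `T` = the unitary representation of the lattice
space group, `Uₗ ∈ T(G)`). This state is positive, normalised, `Uₗ`-invariant (reindex the orbit),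
kills commutators with `A` (every orbit vector is an `E`-eigenvector), the sector ideal and the
commutators with charges acting as real scalars on `K`, gives anti-Hermitian parts zero real part
and pays at most `‖aₖ‖` per residual contraction. Hence (Wang et al., PRX 14 (2024) 031006 §III:
ANY eigenvector is a feasible point; Han, arXiv:2006.06002 §2–3: the symmetry constraints hold for
the symmetrised functional) `c − Σ‖aₖ‖ ≤ Re ω̄_v(X)` (`re_orbitState_ge_of_local_certificate`), and
with density constraints `Σ μᵢ (Dᵢ − νᵢ)` and an energy constraint `κ (u − E_loc)` folded into the
objective — translates of `Dᵢ` / `E_loc` under a sub-family `T'` summing to `Gᵢ = gᵢ` on `K` / to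
`A` — `c − Σ‖aₖ‖ + Σ μᵢ (gᵢ/#V' − νᵢ) + κ (u − E/#V') ≤ Re ω̄_v(X)`
(`re_orbitState_ge_of_local_certificate_ineq`). Since `⟨v, Σ_g T_g X T_gᴴ v⟩ = |G| ω̄_v(X)`
(`vectorState_sum_conj_eq_card_mul_orbitState`), a symmetry-reduced certificate bounds the
space-group AVERAGE of `X` in EVERY eigenvector of the sector below the energy ceiling, degenerate
levels included. Everything is PROVED; `orbitState` is a two-line abbreviation, no named fact.

## References
* J. Wang, J. Surace, I. Frérot, B. Legat, M.-O. Renou, V. Magron, A. Acín, *Certifying ground-state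
  properties of many-body systems*, Phys. Rev. X 14 (2024) 031006, §III. [cite: WangEtAl2024, §III]
* X. Han, *Quantum many-body bootstrap*, arXiv:2006.06002 (2020), §2 eq. (2)–(3), §3.
  [cite: Han2020Bootstrap, §2 eq. (2)–(3)]
* I. Kull, N. Schuch, B. Dive, M. Navascués, PRX 14 (2024) 021008, §5.3. [cite: KullEtAl2024, §5.3]
* O. Bratteli, D. W. Robinson, *Operator Algebras and Quantum Statistical Mechanics II*, 2nd ed.,
  §6.2.4 (space-group-averaged states, mean values). [cite: BratteliRobinsonII1997, §6.2.4]
-/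
noncomputable section

namespace Literature.MathematicalPhysics.QuantumLattice

open Matrix Finset Literature.MathematicalPhysics.QuantumManyBody.StateRelaxation
open scoped ComplexOrder BigOperators

variable {n : Type*} [Fintype n] [DecidableEq n]

section VectorState
omit [DecidableEq n] in
/-- `⟨Uᴴ w, Y Uᴴ w⟩ = ⟨w, U Y Uᴴ w⟩`. [folklore] -/
private theorem vectorState_conjTranspose_mulVec_apply (U Y : Matrix n n ℂ) (w : n → ℂ) :
    vectorState (Uᴴ *ᵥ w) Y = vectorState w (U * Y * Uᴴ) := by
  rw [vectorState_apply, vectorState_apply, star_mulVec, conjTranspose_conjTranspose,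
    ← dotProduct_mulVec, mulVec_mulVec, mulVec_mulVec]

omit [DecidableEq n] in
/-- `⟨w, Vᴴ w⟩ = conj ⟨w, V w⟩`. [folklore] -/
private theorem vectorState_conjTranspose (w : n → ℂ) (V : Matrix n n ℂ) :
    vectorState w Vᴴ = star (vectorState w V) := by
  rw [vectorState_apply, vectorState_apply, dotProduct_mulVec, ← star_mulVec, star_dotProduct]

omit [DecidableEq n] in
/-- Anti-Hermitian parts have purely imaginary expectation in a vector state:
`Re ⟨w, (Vᴴ − V) w⟩ = 0` (identification of a monomial with its adjoint, Han 2020 §2).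
[cite: Han2020Bootstrap, §2] -/
theorem vectorState_re_conjTranspose_sub (w : n → ℂ) (V : Matrix n n ℂ) :
    (vectorState w (Vᴴ - V)).re = 0 := by
  rw [map_sub, vectorState_conjTranspose, Complex.sub_re, Complex.star_def, Complex.conj_re, sub_self]

omit [DecidableEq n] in
/-- A unitary commuting with `A` maps eigenvectors to eigenvectors: `A (Tᴴ v) = E (Tᴴ v)` if
`Tᴴ A = A Tᴴ`. [folklore] -/
private theorem mulVec_conjTranspose_mulVec_of_eigenvector {A T : Matrix n n ℂ} (hTA' : Tᴴ * A = A * Tᴴ)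
    {E : ℂ} {v : n → ℂ} (hAv : A *ᵥ v = E • v) : A *ᵥ (Tᴴ *ᵥ v) = E • (Tᴴ *ᵥ v) := by
  rw [mulVec_mulVec, ← hTA', ← mulVec_mulVec, hAv, mulVec_smul]

/-- `(Q − q·1) w = 0` when `Q w = q w`. [folklore] -/
private theorem sub_smul_one_mulVec_of_eigenvector {Q : Matrix n n ℂ} {q : ℂ} {w : n → ℂ}
    (hQw : Q *ᵥ w = q • w) : (Q - q • (1 : Matrix n n ℂ)) *ᵥ w = 0 := by
  rw [sub_mulVec, smul_mulVec, one_mulVec, hQw, sub_self]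

/-- `(Q − q·1)ᴴ w = 0` when `Q` is Hermitian, `q` real and `Q w = q w`. [folklore] -/
private theorem conjTranspose_sub_smul_one_mulVec_of_eigenvector {Q : Matrix n n ℂ} (hQ : Q.IsHermitian)
    {q : ℝ} {w : n → ℂ} (hQw : Q *ᵥ w = ((q : ℝ) : ℂ) • w) :
    (Q - ((q : ℝ) : ℂ) • (1 : Matrix n n ℂ))ᴴ *ᵥ w = 0 := by
  rw [conjTranspose_sub, conjTranspose_smul, conjTranspose_one, hQ.eq, Complex.star_def,
    Complex.conj_ofReal]
  exact sub_smul_one_mulVec_of_eigenvector hQw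

omit [DecidableEq n] in
/-- A residual contraction costs at most its coefficient in a UNIT vector state:
`−‖a‖ ≤ Re (a ⟨w, M w⟩)` for `‖w‖ = 1`, `M` a contraction. KSDN 2024 §5.3.
[cite: KullEtAl2024, §5.3] -/
theorem neg_norm_le_re_mul_vectorState [DecidableEq n] {M : Matrix n n ℂ} (hM : M.IsContraction)
    (a : ℂ) {w : n → ℂ} (hw : star w ⬝ᵥ w = 1) : -‖a‖ ≤ (a * vectorState w M).re := by
  have h := hM.neg_norm_mul_le a w
  rw [hw, Complex.one_re, mul_one] at h
  rwa [vectorState_apply]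
end VectorState

section OrbitState
variable {G : Type*} [Fintype G]
/-- **The orbit-averaged vector state** `X ↦ |G|⁻¹ Σ_g ⟨T_gᴴ v, X T_gᴴ v⟩` of a vector `v` under a
finite family of matrices `T_g` (the space-group average of a vector state; Bratteli–Robinson II
§6.2.4). [cite: BratteliRobinsonII1997, §6.2.4] -/
def orbitState (T : G → Matrix n n ℂ) (v : n → ℂ) : Matrix n n ℂ →ₗ[ℂ] ℂ :=
  (Fintype.card G : ℂ)⁻¹ • ∑ g, vectorState ((T g)ᴴ *ᵥ v)

omit [DecidableEq n] in
/-- Unfolding `orbitState` (Bratteli–Robinson II §6.2.4). [cite: BratteliRobinsonII1997, §6.2.4] -/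
theorem orbitState_apply (T : G → Matrix n n ℂ) (v : n → ℂ) (X : Matrix n n ℂ) :
    orbitState T v X = (Fintype.card G : ℂ)⁻¹ * ∑ g, vectorState ((T g)ᴴ *ᵥ v) X := by
  simp only [orbitState, LinearMap.smul_apply, LinearMap.coe_sum, Finset.sum_apply, smul_eq_mul]

/-- Averaging a constant over the orbit. [folklore] -/
private theorem card_inv_mul_sum_const [Nonempty G] (z : ℂ) :
    (Fintype.card G : ℂ)⁻¹ * ∑ _g : G, z = z := by
  rw [Finset.sum_const, Finset.card_univ, nsmul_eq_mul,
    inv_mul_cancel_left₀ (Nat.cast_ne_zero.mpr Fintype.card_ne_zero)]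

omit [DecidableEq n] in
/-- `ω̄_v` is positive (the constraint `F[O†O] ≥ 0`, Han 2020 §2). [cite: Han2020Bootstrap, §2] -/
theorem orbitState_nonneg (T : G → Matrix n n ℂ) (v : n → ℂ) (a : Matrix n n ℂ) :
    0 ≤ orbitState T v (star a * a) := by
  rw [orbitState_apply]
  refine mul_nonneg ?_ (Finset.sum_nonneg fun g _ => vectorState_nonneg _ a)
  rw [← Complex.ofReal_natCast, ← Complex.ofReal_inv]
  exact Complex.zero_le_real.mpr (inv_nonneg.mpr (Nat.cast_nonneg _))

omit [Fintype G] in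
/-- The orbit vectors `T_gᴴ v` of a unit vector under unitaries are unit vectors. [folklore] -/
private theorem star_orbitVec_dotProduct_self {T : G → Matrix n n ℂ} (hTT : ∀ g, (T g)ᴴ * T g = 1)
    {v : n → ℂ} (hv : star v ⬝ᵥ v = 1) (g : G) :
    star ((T g)ᴴ *ᵥ v) ⬝ᵥ ((T g)ᴴ *ᵥ v) = 1 := by
  rw [star_mulVec, conjTranspose_conjTranspose, ← dotProduct_mulVec, mulVec_mulVec,
    mul_eq_one_comm.mp (hTT g), one_mulVec, hv]

/-- `ω̄_v` is normalised, `F[1] = 1` (`T_g` unitary, `‖v‖ = 1`; Han 2020 §2). [cite: Han2020Bootstrap, §2] -/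
theorem orbitState_one [Nonempty G] {T : G → Matrix n n ℂ} (hTT : ∀ g, (T g)ᴴ * T g = 1)
    {v : n → ℂ} (hv : star v ⬝ᵥ v = 1) : orbitState T v 1 = 1 := by
  rw [orbitState_apply]
  simp_rw [vectorState_apply, one_mulVec, star_orbitVec_dotProduct_self hTT hv]
  exact card_inv_mul_sum_const 1

omit [DecidableEq n] in
/-- **Invariance of the orbit state**: if the family is closed under right multiplication by `U`
(`T_g U = T_{σ g}` for a permutation `σ`), then `ω̄_v(U Y Uᴴ) = ω̄_v(Y)` (reindex the orbit).
Han 2020 §2 eq. (2), `F[U⁻¹ O U] = F[O]`. [cite: Han2020Bootstrap, §2 eq. (2)] -/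
theorem orbitState_conj_of_closed (T : G → Matrix n n ℂ) (v : n → ℂ) {U : Matrix n n ℂ}
    (hU : ∃ σ : G ≃ G, ∀ g, T g * U = T (σ g)) (Y : Matrix n n ℂ) :
    orbitState T v (U * Y * Uᴴ) = orbitState T v Y := by
  obtain ⟨σ, hσ⟩ := hU
  rw [orbitState_apply, orbitState_apply]
  congr 1
  have hre : ∀ g, vectorState ((T g)ᴴ *ᵥ v) (U * Y * Uᴴ) = vectorState ((T (σ g))ᴴ *ᵥ v) Y := fun g => by
    rw [← vectorState_conjTranspose_mulVec_apply, mulVec_mulVec, ← conjTranspose_mul, hσ g]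
  simp_rw [hre]
  exact Equiv.sum_comp σ (fun g => vectorState ((T g)ᴴ *ᵥ v) Y)

omit [DecidableEq n] in
/-- **Sums of translates**: if every member of a finite family `T'_{v'}` lies in the orbit group in
the sense of `orbitState_conj_of_closed`, then `ω̄_v(Σ_{v'} T'_{v'} Z T'_{v'}ᴴ) = #V' · ω̄_v(Z)`.
Bratteli–Robinson II §6.2.4 (mean values of periodic states). [cite: BratteliRobinsonII1997, §6.2.4] -/
theorem orbitState_sum_conj (T : G → Matrix n n ℂ) (v : n → ℂ) {V' : Type*} [Fintype V']
    (T' : V' → Matrix n n ℂ) (hT' : ∀ v', ∃ σ : G ≃ G, ∀ g, T g * T' v' = T (σ g))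
    (Z : Matrix n n ℂ) :
    orbitState T v (∑ v', T' v' * Z * (T' v')ᴴ) = (Fintype.card V' : ℂ) * orbitState T v Z := by
  rw [map_sum, Finset.sum_congr rfl fun v' _ => orbitState_conj_of_closed T v (hT' v') Z,
    Finset.sum_const, Finset.card_univ, nsmul_eq_mul]

omit [DecidableEq n] in
/-- An operator acting as the scalar `q` on every orbit vector has `ω̄_v(Q) = q` (unit orbit
vectors; the sector constraint, Han 2020 §2 eq. (3)). [cite: Han2020Bootstrap, §2 eq. (3)] -/
theorem orbitState_eq_of_forall_mulVec [Nonempty G] {T : G → Matrix n n ℂ} {v : n → ℂ}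
    (hunit : ∀ g, star ((T g)ᴴ *ᵥ v) ⬝ᵥ ((T g)ᴴ *ᵥ v) = 1) {Q : Matrix n n ℂ} {q : ℂ}
    (hQ : ∀ g, Q *ᵥ ((T g)ᴴ *ᵥ v) = q • ((T g)ᴴ *ᵥ v)) : orbitState T v Q = q := by
  rw [orbitState_apply]
  simp_rw [vectorState_apply, hQ, dotProduct_smul, hunit, smul_eq_mul, mul_one]
  exact card_inv_mul_sum_const q

omit [DecidableEq n] in
/-- **Stationarity / gauge invariance**: `ω̄_v(A X − X A) = 0` when every orbit vector is an
eigenvector of the Hermitian `A` with the same real eigenvalue — used for the Hamiltonian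
(`⟨[H, O]⟩ = 0`) and for conserved charges acting as real scalars on the sector (charged words have
zero expectation). Han 2020 §2. [cite: Han2020Bootstrap, §2] -/
theorem orbitState_commutator {A : Matrix n n ℂ} (hA : A.IsHermitian) {T : G → Matrix n n ℂ}
    {v : n → ℂ} {E : ℝ} (hAw : ∀ g, A *ᵥ ((T g)ᴴ *ᵥ v) = (E : ℂ) • ((T g)ᴴ *ᵥ v))
    (X : Matrix n n ℂ) : orbitState T v (A * X - X * A) = 0 := by
  rw [orbitState_apply]
  simp_rw [vectorState_commutator hA (hAw _)]
  simp

/-- **Sector ideal / conserved charges**: for `Q` Hermitian acting as the real scalar `q` on every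
orbit vector, `ω̄_v(Z (Q − q) + (Q − q) Z') = 0`. Han 2020 §2 eq. (3). [cite: Han2020Bootstrap, §2 eq. (3)] -/
theorem orbitState_sector {T : G → Matrix n n ℂ} {v : n → ℂ} {Q : Matrix n n ℂ} (hQh : Q.IsHermitian)
    {q : ℝ} (hQ : ∀ g, Q *ᵥ ((T g)ᴴ *ᵥ v) = ((q : ℝ) : ℂ) • ((T g)ᴴ *ᵥ v)) (Z Z' : Matrix n n ℂ) :
    orbitState T v (Z * (Q - ((q : ℝ) : ℂ) • 1) + (Q - ((q : ℝ) : ℂ) • 1) * Z') = 0 := by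
  rw [orbitState_apply]
  simp_rw [map_add, vectorState_mul_of_mulVec_eq_zero _ _ (sub_smul_one_mulVec_of_eigenvector (hQ _)),
    vectorState_mul_of_conjTranspose_mulVec_eq_zero _ _
      (conjTranspose_sub_smul_one_mulVec_of_eigenvector hQh (hQ _))]
  simp

omit [DecidableEq n] in
/-- Anti-Hermitian parts with a real coefficient have zero real part in the orbit state.
[cite: Han2020Bootstrap, §2] -/
theorem orbitState_re_real_smul_conjTranspose_sub (T : G → Matrix n n ℂ) (v : n → ℂ) (d : ℝ)
    (V : Matrix n n ℂ) : (orbitState T v (((d : ℝ) : ℂ) • (Vᴴ - V))).re = 0 := by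
  rw [map_smul, smul_eq_mul, Complex.re_ofReal_mul, orbitState_apply]
  have h : (∑ g, vectorState ((T g)ᴴ *ᵥ v) (Vᴴ - V)).re = 0 := by
    rw [Complex.re_sum]
    exact Finset.sum_eq_zero fun g _ => vectorState_re_conjTranspose_sub _ V
  rw [← Complex.ofReal_natCast, ← Complex.ofReal_inv, Complex.re_ofReal_mul, h, mul_zero, mul_zero]

/-- A residual contraction costs at most its coefficient in the orbit state:
`−‖a‖ ≤ Re (a ω̄_v(M))`. KSDN 2024 §5.3. [cite: KullEtAl2024, §5.3] -/
theorem neg_norm_le_re_mul_orbitState [Nonempty G] {T : G → Matrix n n ℂ} {v : n → ℂ}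
    (hunit : ∀ g, star ((T g)ᴴ *ᵥ v) ⬝ᵥ ((T g)ᴴ *ᵥ v) = 1) {M : Matrix n n ℂ}
    (hM : M.IsContraction) (a : ℂ) : -‖a‖ ≤ (a * orbitState T v M).re := by
  rw [orbitState_apply, ← mul_assoc, mul_comm a, mul_assoc, Finset.mul_sum, ← Complex.ofReal_natCast,
    ← Complex.ofReal_inv, Complex.re_ofReal_mul, Complex.re_sum]
  have hG : (0 : ℝ) < Fintype.card G := by exact_mod_cast Fintype.card_pos
  have hsum : ∑ _g : G, -‖a‖ ≤ ∑ g, (a * vectorState ((T g)ᴴ *ᵥ v) M).re :=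
    Finset.sum_le_sum fun g _ => neg_norm_le_re_mul_vectorState hM a (hunit g)
  rw [Finset.sum_const, Finset.card_univ, smul_neg, nsmul_eq_mul] at hsum
  have h := mul_le_mul_of_nonneg_left hsum (inv_nonneg.mpr hG.le)
  rw [mul_neg, ← mul_assoc, inv_mul_cancel₀ hG.ne', one_mul] at h
  exact h

omit [DecidableEq n] in
/-- **The orbit state evaluates orbit-averaged observables exactly as the vector state does**:
`⟨v, (Σ_g T_g X T_gᴴ) v⟩ = |G| · ω̄_v(X)`; so a bound on `ω̄_v(X)` is a bound on the space-group
AVERAGE of `X` in the vector `v` itself. Bratteli–Robinson II §6.2.4. [cite: BratteliRobinsonII1997, §6.2.4] -/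
theorem vectorState_sum_conj_eq_card_mul_orbitState [Nonempty G] (T : G → Matrix n n ℂ) (v : n → ℂ)
    (X : Matrix n n ℂ) :
    vectorState v (∑ g, T g * X * (T g)ᴴ) = (Fintype.card G : ℂ) * orbitState T v X := by
  rw [orbitState_apply, ← mul_assoc, mul_inv_cancel₀ (Nat.cast_ne_zero.mpr Fintype.card_ne_zero),
    one_mul, map_sum]
  exact Finset.sum_congr rfl fun g _ => (vectorState_conjTranspose_mulVec_apply (T g) X v).symm
end OrbitState

section Certificate
variable {G : Type*} [Fintype G] [Nonempty G]
/-- **Local-objective certificate in the orbit-averaged vector state of an eigenvector** (`A`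
Hermitian, `v ∈ K` a unit eigenvector `A v = E v`, `T_g` unitaries commuting with `A`, adjoints
preserving `K`, closed under each symmetry `Uₗ`; `Qᵣ`, `Cⱼ` Hermitian acting as real scalars on `K`;
`dₘ` real; `Mₖ` contractions; `Λ ⪰ 0`): the identity proves `c − Σₖ ‖aₖ‖ ≤ Re ω̄_v(X)`. Han 2020
§2 eq. (2)–(3) with KSDN 2024 §5.3 rounding, for the symmetrised state of an arbitrary eigenvector
(Wang et al. 2024 §III). [cite: Han2020Bootstrap, §2 eq. (2)–(3)] -/
theorem re_orbitState_ge_of_local_certificate {A : Matrix n n ℂ} (hA : A.IsHermitian)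
    (K : Submodule ℂ (n → ℂ)) {E : ℝ} {v : n → ℂ} (hvK : v ∈ K) (hv : star v ⬝ᵥ v = 1)
    (hAv : A *ᵥ v = (E : ℂ) • v)
    (T : G → Matrix n n ℂ) (hTA : ∀ g, T g * A = A * T g) (hTT : ∀ g, (T g)ᴴ * T g = 1)
    (hTK : ∀ g, ∀ w ∈ K, (T g)ᴴ *ᵥ w ∈ K)
    (X : Matrix n n ℂ)
    {m : Type*} [Fintype m] [DecidableEq m] {Λ : Matrix m m ℂ} (hΛ : Λ.PosSemidef)
    (O : m → Matrix n n ℂ)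
    {κ : Type*} (s : Finset κ) (Xc : κ → Matrix n n ℂ)
    {ι : Type*} (t : Finset ι) (U Y : ι → Matrix n n ℂ)
    (hUT : ∀ l ∈ t, ∃ σ : G ≃ G, ∀ g, T g * U l = T (σ g))
    {ρ : Type*} (r : Finset ρ) (Q Z Z' : ρ → Matrix n n ℂ) (q : ρ → ℝ)
    (hQh : ∀ i ∈ r, (Q i).IsHermitian) (hQ : ∀ i ∈ r, ∀ w ∈ K, Q i *ᵥ w = ((q i : ℝ) : ℂ) • w)
    {γ : Type*} (u : Finset γ) (C W : γ → Matrix n n ℂ) (qc : γ → ℝ)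
    (hCh : ∀ j ∈ u, (C j).IsHermitian) (hC : ∀ j ∈ u, ∀ w ∈ K, C j *ᵥ w = ((qc j : ℝ) : ℂ) • w)
    {δ : Type*} (ah : Finset δ) (dc : δ → ℝ) (V : δ → Matrix n n ℂ)
    {κ'' : Type*} (w : Finset κ'') (a : κ'' → ℂ) (M : κ'' → Matrix n n ℂ)
    (hM : ∀ k ∈ w, (M k).IsContraction) {c : ℝ}
    (hcert : X - (c : ℂ) • (1 : Matrix n n ℂ) =
      gramForm Λ O +
        (∑ k ∈ s, (A * Xc k - Xc k * A) + ∑ l ∈ t, (U l * Y l * (U l)ᴴ - Y l) +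
          ∑ i ∈ r, (Z i * (Q i - ((q i : ℝ) : ℂ) • 1) + (Q i - ((q i : ℝ) : ℂ) • 1) * Z' i) +
          ∑ j ∈ u, (C j * W j - W j * C j)) +
        (∑ m' ∈ ah, ((dc m' : ℝ) : ℂ) • ((V m')ᴴ - V m') + ∑ k ∈ w, a k • M k)) :
    c - ∑ k ∈ w, ‖a k‖ ≤ (orbitState T v X).re := by
  have hunit : ∀ g, star ((T g)ᴴ *ᵥ v) ⬝ᵥ ((T g)ᴴ *ᵥ v) = 1 := star_orbitVec_dotProduct_self hTT hv
  have hAw : ∀ g, A *ᵥ ((T g)ᴴ *ᵥ v) = (E : ℂ) • ((T g)ᴴ *ᵥ v) := fun g =>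
    mulVec_conjTranspose_mulVec_of_eigenvector (Matrix.conjTranspose_commute_of_commute hA (hTA g)) hAv
  have hwK : ∀ g, (T g)ᴴ *ᵥ v ∈ K := fun g => hTK g v hvK
  set ω := orbitState T v with hω
  have hpos : ∀ x : Matrix n n ℂ, 0 ≤ ω (star x * x) := fun x => orbitState_nonneg T v x
  have hone : ω 1 = 1 := orbitState_one hTT hv
  have hnull : ω (∑ k ∈ s, (A * Xc k - Xc k * A) + ∑ l ∈ t, (U l * Y l * (U l)ᴴ - Y l) +
      ∑ i ∈ r, (Z i * (Q i - ((q i : ℝ) : ℂ) • 1) + (Q i - ((q i : ℝ) : ℂ) • 1) * Z' i) +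
      ∑ j ∈ u, (C j * W j - W j * C j)) = 0 := by
    rw [map_add, map_add, map_add, map_sum, map_sum, map_sum, map_sum]
    have h1 : ∀ k ∈ s, ω (A * Xc k - Xc k * A) = 0 := fun k _ => orbitState_commutator hA hAw _
    have h2 : ∀ l ∈ t, ω (U l * Y l * (U l)ᴴ - Y l) = 0 := fun l hl => by
      rw [map_sub, hω, orbitState_conj_of_closed T v (hUT l hl) (Y l), sub_self]
    have h3 : ∀ i ∈ r, ω (Z i * (Q i - ((q i : ℝ) : ℂ) • 1) + (Q i - ((q i : ℝ) : ℂ) • 1) * Z' i) = 0 :=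
      fun i hi => orbitState_sector (hQh i hi) (fun g => hQ i hi _ (hwK g)) _ _
    have h4 : ∀ j ∈ u, ω (C j * W j - W j * C j) = 0 := fun j hj =>
      orbitState_commutator (hCh j hj) (fun g => hC j hj _ (hwK g)) _
    rw [Finset.sum_eq_zero h1, Finset.sum_eq_zero h2, Finset.sum_eq_zero h3, Finset.sum_eq_zero h4,
      add_zero, add_zero, add_zero]
  have hres : -(∑ k ∈ w, ‖a k‖) ≤
      (ω (∑ m' ∈ ah, ((dc m' : ℝ) : ℂ) • ((V m')ᴴ - V m') + ∑ k ∈ w, a k • M k)).re := by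
    have hah : (ω (∑ m' ∈ ah, ((dc m' : ℝ) : ℂ) • ((V m')ᴴ - V m'))).re = 0 := by
      rw [map_sum, Complex.re_sum]
      exact Finset.sum_eq_zero fun m' _ => orbitState_re_real_smul_conjTranspose_sub T v (dc m') (V m')
    have hr : -(∑ k ∈ w, ‖a k‖) ≤ (ω (∑ k ∈ w, a k • M k)).re :=
      neg_sum_norm_le_re_map_sum w ω a M fun k hk => neg_norm_le_re_mul_orbitState hunit (hM k hk) (a k)
    rw [map_add, Complex.add_re, hah, zero_add]
    exact hr
  exact le_re_map_of_certificate_residual ω hpos hone hΛ O hnull hres hcert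

/-- **Local-objective certificate WITH DENSITY AND ENERGY CONSTRAINTS in the orbit state**: as
`re_orbitState_ge_of_local_certificate`, with a sub-family `T'_{v'}` of the orbit group translating
a local energy onto `A` (`Σ_{v'} T'_{v'} E_loc T'_{v'}ᴴ = A`) and local densities `Dᵢ` onto operators
`Gᵢ = gᵢ` on `K`; the identity with `Σᵢ μᵢ (Dᵢ − νᵢ·1) + κ (u·1 − E_loc)` folded into the objective
proves `c − Σₖ ‖aₖ‖ + Σᵢ μᵢ (gᵢ/#V' − νᵢ) + κ (u − E/#V') ≤ Re ω̄_v(X)` (no sign condition on `κ`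
at the identity level; with `κ ≥ 0` it is a bound for every eigenvector with `E/#V' ≤ u`, Wang et
al. 2024 §III). [cite: WangEtAl2024, §III] -/
theorem re_orbitState_ge_of_local_certificate_ineq {A : Matrix n n ℂ} (hA : A.IsHermitian)
    (K : Submodule ℂ (n → ℂ)) {E : ℝ} {v : n → ℂ} (hvK : v ∈ K) (hv : star v ⬝ᵥ v = 1)
    (hAv : A *ᵥ v = (E : ℂ) • v)
    (T : G → Matrix n n ℂ) (hTA : ∀ g, T g * A = A * T g) (hTT : ∀ g, (T g)ᴴ * T g = 1)
    (hTK : ∀ g, ∀ w ∈ K, (T g)ᴴ *ᵥ w ∈ K)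
    {V' : Type*} [Fintype V'] [Nonempty V'] (T' : V' → Matrix n n ℂ)
    (hT' : ∀ v', ∃ σ : G ≃ G, ∀ g, T g * T' v' = T (σ g))
    (X Eloc : Matrix n n ℂ) (hE : ∑ v', T' v' * Eloc * (T' v')ᴴ = A) (κ₀ u₀ : ℝ)
    {δ' : Type*} (dens : Finset δ') (μ ν g : δ' → ℝ) (D Gm : δ' → Matrix n n ℂ)
    (hD : ∀ i ∈ dens, ∑ v', T' v' * D i * (T' v')ᴴ = Gm i)
    (hG : ∀ i ∈ dens, ∀ w ∈ K, Gm i *ᵥ w = ((g i : ℝ) : ℂ) • w)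
    {m : Type*} [Fintype m] [DecidableEq m] {Λ : Matrix m m ℂ} (hΛ : Λ.PosSemidef)
    (O : m → Matrix n n ℂ)
    {κ : Type*} (s : Finset κ) (Xc : κ → Matrix n n ℂ)
    {ι : Type*} (t : Finset ι) (U Y : ι → Matrix n n ℂ)
    (hUT : ∀ l ∈ t, ∃ σ : G ≃ G, ∀ g, T g * U l = T (σ g))
    {ρ : Type*} (r : Finset ρ) (Q Z Z' : ρ → Matrix n n ℂ) (q : ρ → ℝ)
    (hQh : ∀ i ∈ r, (Q i).IsHermitian) (hQ : ∀ i ∈ r, ∀ w ∈ K, Q i *ᵥ w = ((q i : ℝ) : ℂ) • w)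
    {γ : Type*} (u : Finset γ) (C W : γ → Matrix n n ℂ) (qc : γ → ℝ)
    (hCh : ∀ j ∈ u, (C j).IsHermitian) (hC : ∀ j ∈ u, ∀ w ∈ K, C j *ᵥ w = ((qc j : ℝ) : ℂ) • w)
    {δ : Type*} (ah : Finset δ) (dc : δ → ℝ) (V : δ → Matrix n n ℂ)
    {κ'' : Type*} (w : Finset κ'') (a : κ'' → ℂ) (M : κ'' → Matrix n n ℂ)
    (hM : ∀ k ∈ w, (M k).IsContraction) {c : ℝ}
    (hcert : X - (c : ℂ) • (1 : Matrix n n ℂ) -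
        ∑ i ∈ dens, ((μ i : ℝ) : ℂ) • (D i - ((ν i : ℝ) : ℂ) • (1 : Matrix n n ℂ)) -
        ((κ₀ : ℝ) : ℂ) • (((u₀ : ℝ) : ℂ) • (1 : Matrix n n ℂ) - Eloc) =
      gramForm Λ O +
        (∑ k ∈ s, (A * Xc k - Xc k * A) + ∑ l ∈ t, (U l * Y l * (U l)ᴴ - Y l) +
          ∑ i ∈ r, (Z i * (Q i - ((q i : ℝ) : ℂ) • 1) + (Q i - ((q i : ℝ) : ℂ) • 1) * Z' i) +
          ∑ j ∈ u, (C j * W j - W j * C j)) +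
        (∑ m' ∈ ah, ((dc m' : ℝ) : ℂ) • ((V m')ᴴ - V m') + ∑ k ∈ w, a k • M k)) :
    c - ∑ k ∈ w, ‖a k‖ + ∑ i ∈ dens, μ i * (g i / (Fintype.card V' : ℝ) - ν i) +
        κ₀ * (u₀ - E / (Fintype.card V' : ℝ)) ≤ (orbitState T v X).re := by
  set X' := X - ∑ i ∈ dens, ((μ i : ℝ) : ℂ) • (D i - ((ν i : ℝ) : ℂ) • (1 : Matrix n n ℂ)) -
    ((κ₀ : ℝ) : ℂ) • (((u₀ : ℝ) : ℂ) • (1 : Matrix n n ℂ) - Eloc) with hX'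
  have hcert' : X' - (c : ℂ) • (1 : Matrix n n ℂ) =
      gramForm Λ O +
        (∑ k ∈ s, (A * Xc k - Xc k * A) + ∑ l ∈ t, (U l * Y l * (U l)ᴴ - Y l) +
          ∑ i ∈ r, (Z i * (Q i - ((q i : ℝ) : ℂ) • 1) + (Q i - ((q i : ℝ) : ℂ) • 1) * Z' i) +
          ∑ j ∈ u, (C j * W j - W j * C j)) +
        (∑ m' ∈ ah, ((dc m' : ℝ) : ℂ) • ((V m')ᴴ - V m') + ∑ k ∈ w, a k • M k) := by
    rw [hX', sub_right_comm _ _ ((c : ℂ) • (1 : Matrix n n ℂ)),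
      sub_right_comm _ _ ((c : ℂ) • (1 : Matrix n n ℂ))]
    exact hcert
  have h := re_orbitState_ge_of_local_certificate hA K hvK hv hAv T hTA hTT hTK X' hΛ O s Xc t U Y
    hUT r Q Z Z' q hQh hQ u C W qc hCh hC ah dc V w a M hM hcert'
  have hunit : ∀ g, star ((T g)ᴴ *ᵥ v) ⬝ᵥ ((T g)ᴴ *ᵥ v) = 1 := star_orbitVec_dotProduct_self hTT hv
  have hAw : ∀ g, A *ᵥ ((T g)ᴴ *ᵥ v) = (E : ℂ) • ((T g)ᴴ *ᵥ v) := fun g =>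
    mulVec_conjTranspose_mulVec_of_eigenvector (Matrix.conjTranspose_commute_of_commute hA (hTA g)) hAv
  have hwK : ∀ g, (T g)ᴴ *ᵥ v ∈ K := fun g => hTK g v hvK
  set ω := orbitState T v with hω
  have hone : ω 1 = 1 := orbitState_one hTT hv
  have hV' : (Fintype.card V' : ℂ) ≠ 0 := Nat.cast_ne_zero.mpr Fintype.card_ne_zero
  have hωE : ω Eloc = (E : ℂ) / (Fintype.card V' : ℂ) := by
    rw [eq_div_iff hV', mul_comm, hω, ← orbitState_sum_conj T v T' hT' Eloc, hE]
    exact orbitState_eq_of_forall_mulVec hunit hAw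
  have hωD : ∀ i ∈ dens, ω (D i) = ((g i : ℝ) : ℂ) / (Fintype.card V' : ℂ) := fun i hi => by
    rw [eq_div_iff hV', mul_comm, hω, ← orbitState_sum_conj T v T' hT' (D i), hD i hi]
    exact orbitState_eq_of_forall_mulVec hunit fun g' => hG i hi _ (hwK g')
  have hωX' : ω X' = ω X -
      ∑ i ∈ dens, ((μ i : ℝ) : ℂ) * (((g i : ℝ) : ℂ) / (Fintype.card V' : ℂ) - ((ν i : ℝ) : ℂ)) -
      ((κ₀ : ℝ) : ℂ) * (((u₀ : ℝ) : ℂ) - (E : ℂ) / (Fintype.card V' : ℂ)) := by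
    rw [hX', map_sub, map_sub, map_sum, map_smul, map_sub, map_smul, hone, hωE, smul_eq_mul, smul_eq_mul,
      mul_one]
    congr 2
    refine Finset.sum_congr rfl fun i hi => ?_
    rw [map_smul, map_sub, map_smul, hone, hωD i hi, smul_eq_mul, smul_eq_mul, mul_one]
  have hre : (ω X').re = (ω X).re - ∑ i ∈ dens, μ i * (g i / (Fintype.card V' : ℝ) - ν i) -
      κ₀ * (u₀ - E / (Fintype.card V' : ℝ)) := by
    rw [hωX']
    have e : ∑ i ∈ dens, ((μ i : ℝ) : ℂ) * (((g i : ℝ) : ℂ) / (Fintype.card V' : ℂ) - ((ν i : ℝ) : ℂ)) +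
        ((κ₀ : ℝ) : ℂ) * (((u₀ : ℝ) : ℂ) - (E : ℂ) / (Fintype.card V' : ℂ)) =
        ((∑ i ∈ dens, μ i * (g i / (Fintype.card V' : ℝ) - ν i) +
          κ₀ * (u₀ - E / (Fintype.card V' : ℝ)) : ℝ) : ℂ) := by
      push_cast
      rfl
    rw [sub_sub, e, Complex.sub_re, Complex.ofReal_re, ← sub_sub]
  rw [hre] at h
  linarith
end Certificate

end Literature.MathematicalPhysics.QuantumLattice

end
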